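import Literature.NumberTheory.Automorphic.Liu2021.Thm418AsPrinted
import Literature.AlgebraicGeometry.Liu2021.AlbaneseUnitaryShimura
import Literature.AlgebraicGeometry.Motives.GoodReduction
import Mathlib.RepresentationTheory.Invariants
import Mathlib.LinearAlgebra.Dimension.Finrank
import Mathlib.LinearAlgebra.SesquilinearForm.Basic
import Mathlib.RingTheory.Unramified.Locus
import Mathlib.Algebra.BigOperators.Finprod
import Mathlib.Algebra.Category.ModuleCat.Basic
import HarnessLib

/-!
# Liu 2021, §4.2 «Albanese of unitary Shimura varieties», part II (print pp. 52–57): items 4.18–4.23 and the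
# canonical pairing (4.3) — STATEMENT CARPET (named facts over the carriers of `Thm418Data`; no proofs)

[Liu2021] = Yifeng Liu, *Fourier–Jacobi cycles and arithmetic relative trace formula* (with an appendix by Chao Li and
Yihang Zhu), Cambridge J. Math. **9** (2021), no. 1, 1–147 (= arXiv:2102.11518).  SOURCES READ FOR THIS FILE: the held
PRINT text (`paper:liu2021-fourier-jacobi-cycles-arithmetic-relative-trace-formula`, page file `pNNNN` = journal page
`N`; pp. 52–57 materialised) — every `(p. N)` below is the journal page of the item's first line — and, as second
locator, the author's TeX source `FJcycle.tex` (md5 `6db49a74122d2cb0f224fa1b39488a0c`, 7163 lines; «l. N»).  Item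
numbers are those of the print = the compiled arXiv v2 (cell concordance `lit/PAGE-CONCORDANCE-Liu2021.md`).

## INDEX of §4.2 part II (every numbered / displayed item ↦ the tree declaration that types it)

| item (print) | page | TeX | declaration |
|---|---|---|---|
| Thm. 4.18 (main iso + (1)(2)(3)) | p. 52 | l. 2232–2245 | CITED, not restated: `Literature.NumberTheory.Automorphic.Liu2021.Thm418AsPrinted` (statement-exact, over the carriers `Thm418Data`; file `Thm418AsPrinted.lean`); earlier readings `Literature.AlgebraicGeometry.Liu2021.LiuAlbaneseCMDatum.Thm418` ∕ `Thm418_1` (file `AlbaneseUnitaryShimuraCM.lean`) and `Literature.AlgebraicGeometry.Liu2021.LiuAlbaneseDatum.Thm418_2` (file `AlbaneseUnitaryShimura.lean`) |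
| «Theorem 4.18 (2,3) allows us to make the following definition» | p. 54 | l. 2292 | `Liu2021_Def419_wellDefined` |
| Def. 4.19 `Ω(μ, ε)` | p. 54 | l. 2294–2296 | `IsOmegaEps` (defining property), `omegaEps` (the submodule) |
| Cor. 4.20, `n ≥ 3` clause + `d(μ,K)` | p. 54 | l. 2301–2312 | CITED, not restated: `Literature.AlgebraicGeometry.Liu2021.LiuAlbaneseDatum.Cor420` (isogeny-monoid reading `[A_K] = Σ_{μ rep} d(μ,K)•[A_μ]`, `d(μ,K) = Σ dim ω^K`), with the kernel proof of «direct consequence of Theorem 4.18» `Literature.AlgebraicGeometry.Liu2021.LiuAlbaneseCMDatum.cor420_of_thm418` (file `AlbaneseIsogenyDecomposition.lean`) |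
| Cor. 4.20, the integer `d(μ,K) := Σ_ε Σ_χ dim_ℂ ω(μ,ε,χ)^K` | p. 55 | l. 2307–2310 | `dMuK` (REAL, over `Thm418Data`) |
| Cor. 4.20, `n = 2` clause (`A_K^{end}`) | p. 54–55 | l. 2304, 2306 | `Liu2021_Cor420_nEqTwo` (over `Cor420EndData` ⊇ `LiuAlbaneseDatum`) |
| «`d(μ,K)` depends only on the `Gal(ℂ/ℚ)`-orbit of `μ`» | p. 55 | l. 2314 | `Liu2021_Cor420_orbitInvariance` |
| Rem. 4.21 (exotic smooth reduction ⇒ `H¹_dR(X_K/E) = 0`) | p. 55 | l. 2321–2323 | `Liu2021_Rem421` |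
| display (4.3): the canonical pairing `( , )_μ : Ω(μ) × Ω(μ^c) → M_μ` | p. 55 | l. 2326–2330 | `Liu2021_Pairing43` |
| Def. 4.22 (1) Hodge divisor `D_K` | p. 55 | l. 2336–2341 | `hodgeDivisor` (REAL case split over two carriers) |
| Def. 4.22 (2) canonical volume `vol(K)` | p. 55 | l. 2343–2347 | `vol` (REAL, `ℚ`-valued) |
| Lem. 4.23 (1)–(4) | p. 55–56 | l. 2351–2362 | `Liu2021_Lem423_1`, `_2`, `_3`, `_4`, conjunction `Liu2021_Lem423` |
| «by Proposition 2.9, we obtain a polarization `θ_K := θ_{X_K,D_K} : A_K^∨ → A_K`» | p. 56 | l. 2370–2373 | carrier inside `Sec42IIData.pairLevel` (Prop. 2.9 itself: §2, not in this block) |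
| display `(φ, φ_c)^K_μ := vol(K) · i_μ^{-1}(φ ∘ θ_K ∘ φ_c^∨) ∈ M_μ` | p. 56 | l. 2379–2381 | `pairLevelVol` (REAL over the carrier `pairLevel`) |
| «`(φ, φ_c)^K_μ` does not depend on the choice of `K`» | p. 56 | l. 2382 | `Liu2021_pairLevel_indepOfLevel` |

Items 4.11–4.17 (§4.2 part I, pp. 45–52) are the sibling carpet `Sec42AlbaneseUnitaryShimuraI.lean` (TL-t02); §2
(Def. 2.8 «almost ample», Prop. 2.9 `θ_{X,D}`, Prop. 2.7) and App. D (D.3) (`A_K^{end}`) are other blocks — the notions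
they define enter here only as ⟨CARRIER⟩ fields with the printed definition quoted.

## What a CARRIER is (same convention as `Thm418AsPrinted.lean`, read that module docstring)

Mathlib and the tree do not construct the compactified unitary Shimura varieties `X_K`, their Chow groups, Hodge
divisors, Albanese varieties `A_K`, `A_K^∨`, the polarization `θ_{X,D}`, `Hom`-groups of abelian varieties over `E`, the
modules `Ω(μ)`, `Ω(μ^c)`, the oscillator representations `ω(μ,ε,χ)`.  Every such object NAMED by a printed sentence is
a field of a hypothesis structure (`Thm418Data` of the sibling file, extended here by `Sec42IIData`; `LiuAlbaneseDatum`
of `AlbaneseUnitaryShimura.lean`, extended here by `Cor420EndData`), marked **⟨CARRIER⟩** and carrying the printed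
definition of the object in its docstring.  Each `Liu2021_… : Prop` below is a PREDICATE on such a datum: NOTHING IS
ASSERTED, nothing is proved; a consumer takes `(h : Liu2021_X D)` for ITS OWN datum `D`; the closed sentence
`∀ D, Liu2021_X D` is not Liu's statement and no declaration here has that type.  Fields not marked ⟨CARRIER⟩ are
genuine Mathlib / tree objects (the number fields `F ⊆ E`, the character `μ`, places of `E`, `M_μ = fieldOfValues E μ`).
«For every sufficiently small open compact subgroup `K`» is READ (R2 of the sibling file) as
`∃ K₀ open compact, ∀ K open compact ≤ K₀, …` (`ForAllSuffSmall`).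

ED.2 (2026-09-02, squad RETRO-AUDIT «review-class fix»): the Compact ∕ Noncompact case split is now REAL (`IsInNoncompactCase`,
`isCompactCase` over the isotropy carrier `isotropicAt`) instead of a bare token; every other statement is byte-identical to ED.1
(p847734).  ED.3 (2026-09-02, TL-plan RULING on the T-ref2 (c) STRENGTH pass, MUST (2)): «`X_K` has proper smooth reduction
at `w`» is now REAL — `HasProperSmoothReductionAt K w := Motives.HasGoodReductionAt (X K) (n − 1) w`, the tree's good-reduction
predicate (`Literature/AlgebraicGeometry/Motives/GoodReduction.lean`: an `IntegralModel` over `𝓞_{E,w}` that `IsSmoothProper`)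
over the new scheme carrier `X : K ↦ X_K` — instead of a `Prop`-valued token; every other statement is byte-identical to ED.2
(p848240).

TYPER LINT: statements only — no `sorry`, no `axiom`, no `instance` declaration and no instance attribute (the new
module-valued carriers are BUNDLED as Mathlib `ModuleCat R` objects, whose carrier types come with their `AddCommGroup` ∕
`Module` structure), no `notation`/`macro`, no attribute removed.
There are no theorems and no proofs in this file.  Hypothesis non-vacuity (the binder lists of `Sec42IIData` and
`Cor420EndData` are jointly inhabited — `Thm418Data.nonempty` supplies a REAL weight-one conjugate symplectic `μ`, the new
carriers are instantiated trivially) and the `rfl` unfoldings are kept in the squad's HOME evidence file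
`T/LIU/TL-t03/g0/Sec42AlbaneseUnitaryShimuraII_full_with_nonvacuity.v3.TL-t03g0.lean` (GREEN), not shipped.

## References

* [Liu2021] Y. Liu, *Fourier–Jacobi cycles and arithmetic relative trace formula*, Camb. J. Math. 9 (2021) 1–147,
  arXiv:2102.11518 — §4.2 pp. 52–57 (Thm. 4.18, Def. 4.19, Cor. 4.20, Rem. 4.21, Def. 4.22, Lem. 4.23, (4.3));
  §2.1 Def. 2.8, Prop. 2.9, Rem. 2.10 (p. 28–29); App. D (D.3) (p. 133).
-/

noncomputable section

open NumberField TensorProduct DirectSum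
open IsDedekindDomain (HeightOneSpectrum)

namespace Literature.NumberTheory.Automorphic.Liu2021.Sec42AlbaneseUnitaryShimuraII

universe u w

variable {F E : Type} [Field F] [NumberField F] [IsTotallyReal F] [Field E] [NumberField E] [Algebra F E]
  [IsTotallyComplex E] [Algebra.IsQuadraticExtension F E]

/-! ## «sufficiently small open compact subgroup» (standing phrase of §4.2, l. 2060; READING R2) -/

/-- «for every sufficiently small open compact subgroup `K ⊆ 𝔾(𝔸_F^∞)`, `P(K)`» READ as: there is an open compact
`K₀` such that `P(K)` for every open compact `K ≤ K₀` (READING R2 of `Thm418AsPrinted.lean`; the Shimura varieties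
`Sh(𝕍)_K`, hence `X_K`, `A_K`, are «indexed by sufficiently small open compact subgroups `K` of `𝔾(𝔸_F^∞)`», p. 45).
[cite: Liu2021, §4.2 (p. 45); Thm. 4.18 (1) (p. 52)] -/
def ForAllSuffSmall (D : Thm418Data F E) (P : Subgroup D.G → Prop) : Prop :=
  ∃ K₀ : Subgroup D.G, IsOpenCompact K₀ ∧ ∀ K : Subgroup D.G, IsOpenCompact K → K ≤ K₀ → P K

/-! ## Def. 4.19 — the submodule `Ω(μ, ε)` (p. 54, l. 2292–2296) -/

/-- A `𝔾(𝔸_F^∞)`-stable `M_μ`-submodule of `Ω(μ)` («`M_μ[𝔾(𝔸_F^∞)]`-submodule of `Ω(μ)`», Def. 4.19, p. 54): an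
`M_μ`-submodule `W ≤ Ω(μ)` with `g · W ⊆ W` for every `g`. [cite: Liu2021, Def. 4.19 (p. 54)] -/
def IsGStableSubmodule (D : Thm418Data F E) (W : Submodule (fieldOfValues E D.μ) D.Ω) : Prop :=
  ∀ (g : D.G) (x : D.Ω), x ∈ W → D.rhoΩ g x ∈ W

/-- **[Liu2021, Def. 4.19] — the defining property of `Ω(μ, ε)`** (p. 54; `FJcycle.tex` l. 2294–2296), VERBATIM: «For
every collection `ε` that is `μ`-admissible, we denote by `Ω(μ, ε)` the unique `M_μ[𝔾(𝔸_F^∞)]`-submodule of `Ω(μ)`,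
such that `Ω(μ, ε) ⊗_{M_μ} ℂ` is isomorphic to `⊕_χ ω(μ, ε, χ)` as a `ℂ[𝔾(𝔸_F^∞)]`-module.»  TYPED, for the datum `D`
of Thm. 4.18 (carriers `Ω(μ)`, `ω(μ,ε,χ)` of `Thm418Data`), a collection `ε : D.Eps` and an `M_μ`-submodule `W ≤ Ω(μ)`:
`W` is `𝔾(𝔸_F^∞)`-stable AND there is a `ℂ`-linear equivalence `ℂ ⊗_{M_μ} W ≃ ⊕_{χ} ω(μ, ε, χ)` (direct sum over ALL
`χ : D.Chi`, as printed «`⊕_χ`») intertwining `g ⊗ 1|_W` with the componentwise action of `g` (READINGS R3, R6 of the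
sibling file: Mathlib's base change `ℂ ⊗[M_μ] W`; `ℂ[G]`-isomorphism = `ℂ`-linear `G`-equivariant equivalence).
[cite: Liu2021, Def. 4.19 (p. 54)] -/
def IsOmegaEps (D : Thm418Data F E) (ε : D.Eps) (W : Submodule (fieldOfValues E D.μ) D.Ω) : Prop :=
  ∃ hW : IsGStableSubmodule D W,
    ∃ Ψ : (ℂ ⊗[fieldOfValues E D.μ] W) ≃ₗ[ℂ] (⨁ χ : D.Chi, D.omega ε χ),
      ∀ (g : D.G) (x : ℂ ⊗[fieldOfValues E D.μ] W) (χ : D.Chi),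
        Ψ (((D.rhoΩ g).restrict (hW g)).baseChange ℂ x) χ = D.rho ε χ g (Ψ x χ)

/-- **[Liu2021, Def. 4.19 — well-definedness]** (p. 54, l. 2292: «Theorem 4.18 (2,3) allows us to make the following
definition», with l. 2294 «the unique `M_μ[𝔾(𝔸_F^∞)]`-submodule of `Ω(μ)`, such that …»): for every `μ`-admissible
`ε` there is EXACTLY ONE `M_μ[𝔾(𝔸_F^∞)]`-submodule `W ≤ Ω(μ)` with `W ⊗_{M_μ} ℂ ≃ ⊕_χ ω(μ,ε,χ)` — the existence-and-
uniqueness claim implicit in the definition (Liu derives it from Thm. 4.18 (2), (3)).  Named fact, no proof.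
[cite: Liu2021, Def. 4.19 (p. 54)] -/
def Liu2021_Def419_wellDefined (D : Thm418Data F E) : Prop :=
  ∀ ε : D.Eps, D.IsAdmissible ε → ∃! W : Submodule (fieldOfValues E D.μ) D.Ω, IsOmegaEps D ε W

/-- **`Ω(μ, ε)`** (Def. 4.19, p. 54): THE submodule with the defining property `IsOmegaEps D ε`, extracted from a proof
`h` that one exists (supplied by a consumer from `Liu2021_Def419_wellDefined`, i.e. from Thm. 4.18 (2,3)); by
uniqueness (same fact) it does not depend on `h`; its defining property is `h.choose_spec`.  No junk value: without
`h` the definition cannot be applied. [cite: Liu2021, Def. 4.19 (p. 54)] -/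
def omegaEps (D : Thm418Data F E) (ε : D.Eps) (h : ∃ W : Submodule (fieldOfValues E D.μ) D.Ω, IsOmegaEps D ε W) :
    Submodule (fieldOfValues E D.μ) D.Ω :=
  h.choose

/-! ## Cor. 4.20 — the integer `d(μ, K)` (p. 55, l. 2307–2310), REAL over `Thm418Data` -/

/-- The `K`-invariants `ω(μ, ε, χ)^K` of a subgroup `K ≤ 𝔾(𝔸_F^∞)` in the summand `ω_i = ω(μ,ε,χ)`, `i = (ε, χ)`, as a
`ℂ`-subspace (Mathlib's `Representation.invariants` of the restriction of the action to `K`).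
[cite: Liu2021, Cor. 4.20 (p. 55)] -/
def omegaInvariants (D : Thm418Data F E) (i : D.AdmIndex) (K : Subgroup D.G) : Submodule ℂ (D.omegaAt i) :=
  Representation.invariants (k := ℂ) (G := K) (V := D.omegaAt i) ((D.rhoAt i).comp K.subtype)

/-- **`d(μ, K)`** (Cor. 4.20, p. 55; l. 2307–2310), VERBATIM: «`d(μ, K) := Σ_ε Σ_χ dim_ℂ ω(μ, ε, χ)^K`, where the sum is
taken over all `ε, χ` such that `ε` is `μ`-admissible.»  REAL: the sum over the index type `AdmIndex` of Thm. 4.18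
(pairs `(ε, χ)` with `ε` `μ`-admissible) of `finrank_ℂ ω(μ,ε,χ)^K`, as a `finsum` (the printed sum is finite for the
`K` in question — finitely many summands have `ω^K ≠ 0`, `ω` admissible —; `finsum` returns `0` on an infinite support
and `finrank` returns `0` on an infinite-dimensional space, the usual Mathlib conventions, immaterial where the printed
integer is meant). [cite: Liu2021, Cor. 4.20 (p. 55)] -/
def dMuK (D : Thm418Data F E) (K : Subgroup D.G) : ℕ :=
  ∑ᶠ i : D.AdmIndex, Module.finrank ℂ (omegaInvariants D i K)

/-! ## Cor. 4.20 — the `n = 2` clause and the orbit sentence, over the carriers of the tree's `Cor420` -/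

/-- **Carriers for the `n = 2` clause of [Liu2021, Cor. 4.20] and the sentence after it** (p. 54–55), EXTENDING the
tree's `Literature.AlgebraicGeometry.Liu2021.LiuAlbaneseDatum` (file `AlbaneseUnitaryShimura.lean`: `Char` = weight-one
conjugate symplectic automorphic characters of `𝔸_E^×`, `Adm μ` = `μ`-admissible completions `(ε, χ)`, `Level` =
sufficiently small open compact `K`, `alb K = [A_K]`, `Amu μ = [A_μ]` in an isogeny monoid `Isog` of abelian varieties
over `E` (additive: `[A × B] = [A] + [B]`), `isRep μ` = «`μ` is the chosen representative of its `Gal(ℂ/ℚ)`-orbit»,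
`d μ K = d(μ, K)`, `n` = rank of `𝕍`) — over which the `n ≥ 3` clause is ALREADY typed as `LiuAlbaneseDatum.Cor420` —
by two further carriers.  Nothing is asserted. [cite: Liu2021, Cor. 4.20 (p. 54–55)] -/
structure Cor420EndData (Isog : Type w) extends Literature.AlgebraicGeometry.Liu2021.LiuAlbaneseDatum.{u, w} Isog where
  /-- ⟨CARRIER⟩ `K ↦ [A_K^{end}]`, the isogeny class of «`A_K^{end}`, the endoscopic part of `A_K` when `n = 2`, defined
  in (D.3)» (Cor. 4.20, p. 55; (D.3) is on p. 133, App. D §D.3: the abelian subvariety of `A_K = Alb_{X_K}` of the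
  unitary Shimura CURVE `X_K` cut out by the endoscopic part of its cohomology).  Meaningful only when `n = 2`. -/
  albEnd : Level → Isog
  /-- ⟨CARRIER⟩ «`μ` and `μ'` lie in the same `Gal(ℂ/ℚ)`-orbit» (Cor. 4.20, p. 54: «the product is taken over
  representatives of `Gal(ℂ/ℚ)`-orbits of all conjugate symplectic automorphic characters of `𝔸_E^×` of weight one»;
  `Gal(ℂ/ℚ)` is Liu's notation for `Aut(ℂ/ℚ)`, acting on `μ` through its algebraic avatar `μ^{alg}`, §4.1 p. 41). -/
  sameOrbit : Char → Char → Prop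

/-- **[Liu2021, Cor. 4.20], the `n = 2` clause** (p. 54–55; l. 2301–2312), VERBATIM (whole corollary): «Take an arbitrary
object `D_μ = (A_μ, i_μ, λ_μ, r_μ) ∈ 𝒜(μ)`. For every sufficiently small open compact subgroup `K` of `𝔾(𝔸_F^∞)`, there
is an isogeny decomposition `A_K ∼ ∏_μ A_μ^{d(μ,K)}`, resp. `A_K^{end} ∼ ∏_μ A_μ^{d(μ,K)}` of abelian varieties over `E`
when `n ≥ 3` (resp. `n = 2`), where the product is taken over representatives of `Gal(ℂ/ℚ)`-orbits of all conjugate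
symplectic automorphic characters of `𝔸_E^×` of weight one. Here, `A_K^{end}` is the endoscopic part of `A_K` when
`n = 2`, defined in (D.3), and `d(μ, K) := Σ_ε Σ_χ dim_ℂ ω(μ, ε, χ)^K`, where the sum is taken over all `ε, χ` such that
`ε` is `μ`-admissible.»  The `n ≥ 3` clause is the tree's `LiuAlbaneseDatum.Cor420` (SAME reading, same carriers; not
restated).  TYPED here, the «resp.» clause in that reading: if `n = 2`, then for every level `K` of the carrier,
`[A_K^{end}] = Σ_{μ representative} d(μ,K) • [A_μ]` in the isogeny monoid (a `finsum`; Krull–Schmidt for abelian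
varieties up to isogeny makes «`∼ ∏ A_μ^{d}`» this identity), and `d(μ,K) = Σ_{(ε,χ)} dim ω(μ,ε,χ)^K`.
[cite: Liu2021, Cor. 4.20 (p. 54)] -/
def Liu2021_Cor420_nEqTwo {Isog : Type w} [AddCommMonoid Isog] (D : Cor420EndData.{u, w} Isog) : Prop :=
  D.n = 2 →
    (∀ K : D.Level, D.albEnd K = ∑ᶠ μ : {μ : D.Char // D.isRep μ}, D.d μ.1 K • D.Amu μ.1) ∧
    ∀ (μ : D.Char) (K : D.Level), D.d μ K = ∑ᶠ a : D.Adm μ, D.invDim (D.omega μ a) K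

/-- **[Liu2021, after Cor. 4.20]** (p. 55; l. 2314), VERBATIM: «It is clear that the integer `d(μ, K)` depends only on the
`Gal(ℂ/ℚ)`-orbit of `μ`.»  TYPED over the carriers: characters in the same orbit have the same `d(·, K)` at every
level. [cite: Liu2021, Cor. 4.20 (p. 55)] -/
def Liu2021_Cor420_orbitInvariance {Isog : Type w} (D : Cor420EndData.{u, w} Isog) : Prop :=
  ∀ μ μ' : D.Char, D.sameOrbit μ μ' → ∀ K : D.Level, D.d μ K = D.d μ' K

/-! ## The data of Rem. 4.21, Def. 4.22, Lem. 4.23 and the pairing (4.3): `Sec42IIData` ⊇ `Thm418Data` -/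

/-- **Carriers for [Liu2021, §4.2 pp. 55–56]** (Rem. 4.21, Def. 4.22, Lem. 4.23, the polarization `θ_K`, the pairing
(4.3)), EXTENDING the datum `Thm418Data F E` of Thm. 4.18 (number fields `F ⊆ E` with the printed hypotheses as instance
arguments; `n ≥ 2`; ⟨CARRIER⟩ `𝕍`, `G = 𝔾(𝔸_F^∞)`, `Eps`, `Chi`, `Obj = 𝒜(μ)`, `ω(μ,ε,χ)`, `Ω(μ)`, `Hom_E(A_K, A_μ)_ℚ`;
REAL `μ`, `M_μ = fieldOfValues E μ`).  Fields marked ⟨CARRIER⟩ stand for printed objects Lean cannot construct and quote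
their printed definition; the others are genuine.  Nothing is asserted by this structure.
[cite: Liu2021, §4.2 (pp. 45–46, 55–56); Def. 2.8, Prop. 2.9 (p. 28)] -/
structure Sec42IIData (F E : Type) [Field F] [NumberField F] [IsTotallyReal F] [Field E] [NumberField E]
    [Algebra F E] [IsTotallyComplex E] [Algebra.IsQuadraticExtension F E] extends Thm418Data F E where
  /-- ⟨CARRIER⟩ `p ↦` «the hermitian space `𝕍 ⊗_𝔸 ℚ_p` is isotropic» for a rational prime `p` (p. 45, in the definition of
  the Noncompact Case) — the only non-REAL ingredient of the case split; the split itself is the REAL `IsInNoncompactCase` ∕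
  `isCompactCase` below (ED.2: was a bare token `isCompactCase : Prop` in ED.1 — «posited though definable»; same shape as the
  tree's `AppendixC.Glue` `Sec42Data.IsNoncompactCase` — distinct short name on purpose). -/
  isotropicAt : ℕ → Prop
  /-- ⟨CARRIER⟩ `K ↦ CH¹(X_K)_ℚ`, the rational Chow group of divisors of `X_K := \widetilde{Sh}(𝕍)_K` («the compactified
  Shimura variety», Def. C.8; «`{X_K}_K` is a projective system of smooth projective schemes in `Sch_{/E}` of dimension
  `n − 1`», p. 45–46), for `K` sufficiently small open compact (values at other `K` never used).  Bundled as a Mathlib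
  `ModuleCat ℚ` object (a `ℚ`-vector space with its structure; no instance declarations needed). -/
  CH1 : Subgroup G → ModuleCat.{0} ℚ
  /-- ⟨CARRIER⟩ `(u^{K'}_K)^* : CH¹(X_K)_ℚ → CH¹(X_{K'})_ℚ`, pull-back along «the transition morphism
  `u^{K'}_K : X_{K'} → X_K`, which is a generically finite dominant morphism» (p. 46), for `K' ⊆ K`. -/
  transPullback : ∀ {K' K : Subgroup G}, K' ≤ K → (CH1 K →ₗ[ℚ] CH1 K')
  /-- ⟨CARRIER⟩ `T_g^* : CH¹(X_K)_ℚ → CH¹(X_{gKg⁻¹})_ℚ`, pull-back along «the Hecke translation `T_g : X_{gKg^{-1}} → X_K`»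
  (Lem. 4.23 (3), p. 56); `gKg⁻¹` is REAL: the image of `K` under conjugation by `g` (`MulAut.conj g`). -/
  heckePullback : ∀ (g : G) (K : Subgroup G), (CH1 K →ₗ[ℚ] CH1 (K.map (MulAut.conj g).toMonoidHom))
  /-- ⟨CARRIER⟩ the class in `CH¹(X_K)_ℚ` of «the usual Hodge divisor on the Shimura variety `Sh(𝕍)_K`» when `Sh(𝕍)_K` is
  proper (`= X_K`; Compact Case) (Def. 4.22 (1), first bullet, p. 55). -/
  usualHodgeDivisor : ∀ K : Subgroup G, CH1 K
  /-- ⟨CARRIER⟩ the class in `CH¹(X_K)_ℚ` of «the canonical extension of the usual Hodge divisor on `Sh(𝕍)_K` to `X_K`»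
  when `Sh(𝕍)_K` is not proper (Noncompact Case) (Def. 4.22 (1), second bullet, p. 55). -/
  extendedHodgeDivisor : ∀ K : Subgroup G, CH1 K
  /-- ⟨CARRIER⟩ «almost ample» for a class in `CH¹(X_K)_ℚ` — Def. 2.8 (p. 28), VERBATIM: «We say that a divisor `D` on a
  proper smooth scheme `X` over `k` is almost ample if there exists `m ∈ ℤ_{>0}` such that `|mD|` is base point free and
  that the induced morphism `φ_{mD} : X → ℙ(|mD|)` is a generically finite morphism onto its image.» (§2 is typed in the
  carpet `Sec2AlbaneseVariety.lean`; a token predicate here.) -/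
  IsAlmostAmple : ∀ K : Subgroup G, CH1 K → Prop
  /-- ⟨CARRIER⟩ `π₀(X_K)`, the (finite) set of connected components of `X_K` (Lem. 4.23 (4), p. 56). -/
  pi0 : Subgroup G → Type
  /-- ⟨CARRIER⟩ `(D, c) ↦ deg (D^{n−1}|_c)`, «the degree function `deg D^{n−1}` … on `π₀(X_K)`» (Lem. 4.23 (4), p. 56; cf.
  Prop. 2.7, p. 27: a degree «regarded as a function on `π₀(X)` whose value on a connected component … is the total degree
  … over it»): the degree of the top self-intersection of `D ∈ CH¹(X_K)_ℚ` on the component `c` (`dim X_K = n − 1`). -/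
  degTop : ∀ K : Subgroup G, CH1 K → pi0 K → ℚ
  /-- ⟨CARRIER⟩ `|π₀((X_K)_{E^{ac}})|`, the number of geometric connected components of `X_K` (Def. 4.22 (2), p. 55). -/
  numGeomComponents : Subgroup G → ℕ
  /-- ⟨CARRIER⟩ `deg D_K^{n−1}` «regarded as a constant positive integer by Lemma 4.23 (4)» (Def. 4.22 (2), p. 55): the
  common value of `degTop K D_K` on `π₀(X_K)`; that it IS that common value and is positive is `Liu2021_Lem423_4`. -/
  hodgeDegree : Subgroup G → ℕ
  /-- ⟨CARRIER⟩ the `M_μ`-module `Ω(μ^c)` (Def. 4.16 applied to `μ^c := μ ∘ c`, conjugate symplectic of weight one by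
  Rem. 4.4; p. 55 display (4.3)).  `M_{μ^c} = M_μ` (the values `μ^{c,alg}(x) = μ^{alg}(x^c)` generate the same field), and
  (4.3) is «`M_μ`-bilinear», so `Ω(μ^c)` is recorded as an `M_μ`-module. -/
  Ωc : ModuleCat.{0} (fieldOfValues E μ)
  /-- ⟨CARRIER⟩ the `M_μ`-linear action of `𝔾(𝔸_F^∞)` on `Ω(μ^c)` (Def. 4.16: «acts `M_μ`-linearly via its action on
  `A_∞`»). -/
  rhoΩc : Representation (fieldOfValues E μ) G Ωc
  /-- ⟨CARRIER⟩ `Hom_E(A_K, A_μ^∨)_ℚ` for a level `K` and an object `D_μ = (A_μ, i_μ, λ_μ, r_μ) ∈ 𝒜(μ)`, `A_μ^∨` the dual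
  abelian variety — the level-`K` piece of `Ω(μ^c) = Hom_E(A_∞, A_μ^∨)_ℚ` computed with «the object
  `D_μ^∨ = (A_μ^∨, i_μ^∨, λ_μ^∨, r_μ^∨) ∈ 𝒜(μ^c)`» induced by `D_μ` (p. 56). -/
  HomKc : Subgroup G → Obj → ModuleCat.{0} ℚ
  /-- ⟨CARRIER⟩ the canonical map `Hom_E(A_K, A_μ^∨)_ℚ → Ω(μ^c)` (composition with `A_∞ → A_K`, then Rem. 4.17 for `μ^c`),
  companion of `Thm418Data.res`. -/
  resc : ∀ K D, HomKc K D →+ Ωc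
  /-- ⟨CARRIER⟩ for `K' ⊆ K`: `Hom_E(A_K, A_μ)_ℚ → Hom_E(A_{K'}, A_μ)_ℚ`, composition with `Alb(u^{K'}_K) : A_{K'} → A_K`
  («By functoriality, we obtain a projective system `{A_K}_K`», p. 46). -/
  transHom : ∀ {K' K : Subgroup G}, K' ≤ K → ∀ D : Obj, HomK K D →+ HomK K' D
  /-- ⟨CARRIER⟩ the same for `Hom_E(A_K, A_μ^∨)_ℚ`. -/
  transHomc : ∀ {K' K : Subgroup G}, K' ≤ K → ∀ D : Obj, HomKc K D →+ HomKc K' D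
  /-- ⟨CARRIER⟩ `(φ, φ_c) ↦ i_μ^{-1}(φ ∘ θ_K ∘ φ_c^∨) ∈ M_μ` for `φ ∈ Hom_E(A_K, A_μ)_ℚ`, `φ_c ∈ Hom_E(A_K, A_μ^∨)_ℚ` (p. 56;
  l. 2376–2381): here `θ_K := θ_{X_K, D_K} : A_K^∨ → A_K` is the polarization attached to the almost ample Hodge divisor
  `D_K` by Prop. 2.9 (p. 28: «Let `X` be a proper smooth scheme in `Sch_{/k}` [`char k = 0`] and `D` a divisor on `X` such
  that `D` is almost ample. Then the symmetric homomorphism `θ_{X,D} : Alb_X^∨ → Alb_X` is a polarization»), and «The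
  composite map `A_μ ≃ A_μ^{∨∨} = (A_{μ^c})^∨ →^{φ_c^∨} A_K^∨ →^{θ_K} A_K →^{φ} A_μ` belongs to `End_E(A_μ)_ℚ = i_μ(M_μ)`»
  (p. 56), pulled back to `M_μ` along the CM structure `i_μ` (Def. 4.5 (2)).  `ℤ`-bilinear (composition is additive in
  each variable). -/
  pairLevel : ∀ (K : Subgroup G) (D : Obj), HomK K D →+ HomKc K D →+ fieldOfValues E μ
  /-- ⟨CARRIER⟩ `K ↦ H¹_dR(X_K/E)`, the first algebraic de Rham cohomology over `E` of the scheme `X_K` (the carrier `X K`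
  below; Rem. 4.21, p. 55) — Mathlib has no algebraic de Rham cohomology of schemes, so the `E`-module is posited. -/
  H1dR : Subgroup G → ModuleCat.{0} E
  /-- ⟨CARRIER⟩ `K ↦ X_K`, the `E`-scheme «`X_K := \widetilde Sh(𝕍)_K`» (p. 45; `FJcycle.tex` l. 2062–2064: «In all cases, we
  have the compactified Shimura variety `\widetilde Sh(𝕍)_K` (Definition C.8). Put `X_K := \widetilde Sh(𝕍)_K` for short.
  Then `{X_K}_K` is a projective system of smooth projective schemes in `Sch_{/E}` of dimension `n − 1`»), as an object of
  the tree's `Motives.SchemeOver E = Over (Spec E)`; defined for `K` sufficiently small open compact (its values at other `K`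
  are never used).  For data glued from Prop. C.5 this is ★ `AppendixC.Glue.Sec42Data.X (levelOf K)`.  (ED.3: new carrier,
  so that «proper smooth reduction at `w`» below is the tree's REAL good-reduction predicate of this scheme.) -/
  X : Subgroup G → Literature.AlgebraicGeometry.Motives.SchemeOver E

namespace Sec42IIData

/-! ### Rem. 4.21 (p. 55, l. 2321–2323) -/

omit [NumberField F] [IsTotallyReal F] [NumberField E] [IsTotallyComplex E] [Algebra.IsQuadraticExtension F E] in
/-- A finite place `w` of `E` «that is ramified over `F`» (Rem. 4.21, p. 55) — REAL: the prime `w` of `𝓞_E` is NOT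
unramified over `𝓞_F` (Mathlib's `Algebra.IsUnramifiedAt`; for the quadratic `E/F`, ramified = ramification index `2`).
[cite: Liu2021, Rem. 4.21 (p. 55)] -/
def IsRamifiedOverF (w : HeightOneSpectrum (𝓞 E)) : Prop :=
  ¬ Algebra.IsUnramifiedAt (𝓞 F) w.asIdeal

variable (D : Sec42IIData F E)

/-! ### The case split of §4.2 (p. 45), REAL over the isotropy carrier (ED.2) -/

/-- **Noncompact Case** (p. 45; `FJcycle.tex` l. 2055), VERBATIM: «Noncompact Case: `d = 1`, and either `n ≥ 3` or `n = 2` and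
the hermitian space `𝕍 ⊗_𝔸 ℚ_p` is isotropic for every rational prime `p`.» — REAL: `d = [F:ℚ] = Module.finrank ℚ F`, `n = D.n`,
isotropy through the carrier `isotropicAt`. [cite: Liu2021, §4.2 (p. 45)] -/
def IsInNoncompactCase : Prop :=
  Module.finrank ℚ F = 1 ∧ (3 ≤ D.n ∨ (D.n = 2 ∧ ∀ p : ℕ, p.Prime → D.isotropicAt p))

/-- **Compact Case** (p. 45; l. 2057), VERBATIM: «Compact Case: if it is not in the Noncompact Case.»  («[`Sh(𝕍)_K`] is
projective if and only if we are in the Compact Case», p. 45.)  REAL (ED.2; the ED.1 field of this name was a token).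
[cite: Liu2021, §4.2 (p. 45)] -/
def isCompactCase : Prop :=
  ¬ D.IsInNoncompactCase

/-! ### Rem. 4.21 (p. 55): proper smooth reduction, REAL over the scheme carrier `X` (ED.3) -/

/-- «`X_K` has proper smooth reduction at [the nonarchimedean place `w`] of `E`» (Rem. 4.21, p. 55; l. 2321–2323), `w` a
finite place of `E` (a nonzero prime of `𝓞_E`) — REAL (ED.3; the ED.1∕ED.2 field of this name was a `Prop`-valued token):
the `E`-scheme `X_K` (carrier `D.X K`), smooth projective of dimension `n − 1` (p. 45), admits an integral model over the
local ring `𝓞_{E,w}` that is proper and smooth of relative dimension `n − 1`, i.e. the tree's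
`Motives.HasGoodReductionAt (D.X K) (D.n − 1) w` (`∃ 𝒳 : IntegralModel 𝓞_{E,w} E X_K, 𝒳.IsSmoothProper (n − 1)`,
file `Literature/AlgebraicGeometry/Motives/GoodReduction.lean`, Serre–Tate 1968 §1). [cite: Liu2021, Rem. 4.21 (p. 55)] -/
def HasProperSmoothReductionAt (K : Subgroup D.G) (w : HeightOneSpectrum (𝓞 E)) : Prop :=
  Literature.AlgebraicGeometry.Motives.HasGoodReductionAt (D.X K) (D.n - 1) w

/-- «`X_K` has exotic smooth reduction, that is, `X_K` has proper smooth reduction at some nonarchimedean place of `E`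
that is ramified over `F`» (Rem. 4.21, p. 55). [cite: Liu2021, Rem. 4.21 (p. 55)] -/
def HasExoticSmoothReduction (K : Subgroup D.G) : Prop :=
  ∃ w : HeightOneSpectrum (𝓞 E), IsRamifiedOverF (F := F) w ∧ D.HasProperSmoothReductionAt K w

/-- **[Liu2021, Rem. 4.21]** (p. 55; `FJcycle.tex` l. 2321–2323), VERBATIM: «Corollary 4.20 has a very interesting
implication. Namely, if `n ≥ 3` and `X_K` has exotic smooth reduction, that is, `X_K` has proper smooth reduction at
some nonarchimedean place of `E` that is ramified over `F`, then `H¹_dR(X_K/E) = {0}` since `A_μ` cannot have good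
reduction at such a place.»  TYPED: if `3 ≤ n` then, for every sufficiently small open compact `K` (the `K` for which
`X_K` is defined, READING R2), exotic smooth reduction of `X_K` forces `H¹_dR(X_K/E) = 0` (a subsingleton).  The clause
«since `A_μ` cannot have good reduction at such a place» is the printed reason, not part of the claim.
[cite: Liu2021, Rem. 4.21 (p. 55)] -/
def Liu2021_Rem421 : Prop :=
  3 ≤ D.n → ForAllSuffSmall D.toThm418Data fun K => D.HasExoticSmoothReduction K → Subsingleton (D.H1dR K)

/-! ### Def. 4.22 (p. 55, l. 2333–2349) -/

/-- **[Liu2021, Def. 4.22 (1)] the Hodge divisor `D_K`** (p. 55; l. 2336–2341), VERBATIM: «We define (1) the *Hodge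
divisor* `D_K` on `X_K`, as an element in `CH¹(X_K)_ℚ`, to be • the usual Hodge divisor on the Shimura variety `Sh(𝕍)_K`
if `Sh(𝕍)_K` is proper (Compact Case), • the canonical extension of the usual Hodge divisor on `Sh(𝕍)_K` to `X_K` if
`Sh(𝕍)_K` is not proper (Noncompact Case).»  REAL case split over the two carriers (`Sh(𝕍)_K` is proper iff Compact
Case, p. 45): `if isCompactCase then usualHodgeDivisor K else extendedHodgeDivisor K` (reduces by `if_pos` ∕ `if_neg`).
[cite: Liu2021, Def. 4.22 (1) (p. 55)] -/
def hodgeDivisor (K : Subgroup D.G) : D.CH1 K :=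
  @ite (D.CH1 K) D.isCompactCase (Classical.dec _) (D.usualHodgeDivisor K) (D.extendedHodgeDivisor K)

/-- **[Liu2021, Def. 4.22 (2)] the canonical volume** (p. 55; l. 2343–2347), VERBATIM: «(2) the *canonical volume* of `K`
to be `vol(K) := 1 / (deg D_K^{n−1} · |π₀((X_K)_{E^{ac}})|)`, in which `deg D_K^{n−1}` is regarded as a constant positive
integer by Lemma 4.23 (4) below.»  REAL rational number over the carriers `hodgeDegree K = deg D_K^{n−1}` and
`numGeomComponents K = |π₀((X_K)_{E^{ac}})|`. [cite: Liu2021, Def. 4.22 (2) (p. 55)] -/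
def vol (K : Subgroup D.G) : ℚ :=
  1 / ((D.hodgeDegree K : ℚ) * (D.numGeomComponents K : ℚ))

/-! ### Lem. 4.23 (p. 55–56, l. 2351–2362) -/

/-- **[Liu2021, Lem. 4.23 (1)]** (p. 55; l. 2354), VERBATIM: «The Hodge divisor `D_K` is almost ample (Definition 2.8).»
— for every (sufficiently small open compact) `K`, over the carrier predicate `IsAlmostAmple` (Def. 2.8 quoted on the
field). [cite: Liu2021, Lem. 4.23 (1) (p. 55)] -/
def Liu2021_Lem423_1 : Prop :=
  ForAllSuffSmall D.toThm418Data fun K => D.IsAlmostAmple K (D.hodgeDivisor K)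

/-- **[Liu2021, Lem. 4.23 (2)]** (p. 55; l. 2356), VERBATIM: «For every transition morphism `u^{K'}_K : X_{K'} → X_K`,
`(u^{K'}_K)^* D_K` is rationally equivalent to `D_{K'}`.» — equality in `CH¹(X_{K'})_ℚ` (where `D_K` lives, Def. 4.22
(1)), for all sufficiently small open compact `K' ⊆ K`. [cite: Liu2021, Lem. 4.23 (2) (p. 55)] -/
def Liu2021_Lem423_2 : Prop :=
  ForAllSuffSmall D.toThm418Data fun K =>
    ∀ (K' : Subgroup D.G) (hK' : K' ≤ K), IsOpenCompact K' →
      D.transPullback hK' (D.hodgeDivisor K) = D.hodgeDivisor K'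

/-- **[Liu2021, Lem. 4.23 (3)]** (p. 56; l. 2358), VERBATIM: «For every `g ∈ 𝔾(𝔸_F^∞)`, `T_g^* D_K` is rationally
equivalent to `D_{gKg^{-1}}`, where `T_g : X_{gKg^{-1}} → X_K` is the Hecke translation.» — equality in
`CH¹(X_{gKg⁻¹})_ℚ`, for all sufficiently small open compact `K` and all `g`. [cite: Liu2021, Lem. 4.23 (3) (p. 56)] -/
def Liu2021_Lem423_3 : Prop :=
  ForAllSuffSmall D.toThm418Data fun K =>
    ∀ g : D.G, D.heckePullback g K (D.hodgeDivisor K) = D.hodgeDivisor (K.map (MulAut.conj g).toMonoidHom)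

/-- **[Liu2021, Lem. 4.23 (4)]** (p. 56; l. 2360), VERBATIM: «The degree function `deg D_K^{n−1}` is a constant positive
integer on `π₀(X_K)`.» — TYPED: for all sufficiently small open compact `K`, the carrier integer `hodgeDegree K` is
positive and `deg(D_K^{n−1}|_c) = hodgeDegree K` for every component `c ∈ π₀(X_K)` (this also pins the carrier
`hodgeDegree` used by `vol`, Def. 4.22 (2)). [cite: Liu2021, Lem. 4.23 (4) (p. 56)] -/
def Liu2021_Lem423_4 : Prop :=
  ForAllSuffSmall D.toThm418Data fun K =>
    0 < D.hodgeDegree K ∧ ∀ c : D.pi0 K, D.degTop K (D.hodgeDivisor K) c = (D.hodgeDegree K : ℚ)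

/-- **[Liu2021, Lem. 4.23]** (p. 55–56; l. 2351–2362): «We have (1) … (2) … (3) … (4) …» — the conjunction of the four
items. [cite: Liu2021, Lem. 4.23 (p. 55)] -/
def Liu2021_Lem423 : Prop :=
  D.Liu2021_Lem423_1 ∧ D.Liu2021_Lem423_2 ∧ D.Liu2021_Lem423_3 ∧ D.Liu2021_Lem423_4

/-! ### The pairing (4.3) (p. 55 display; construction p. 56, l. 2370–2382) -/

/-- **`(φ, φ_c)^K_μ`** (p. 56; l. 2379–2381), VERBATIM: «Now we define `(φ, φ_c)^K_μ := vol(K) · i_μ^{-1}(φ ∘ θ_K ∘ φ_c^∨)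
∈ M_μ`.»  REAL over the carrier `pairLevel K D_μ (φ, φ_c) = i_μ^{-1}(φ ∘ θ_K ∘ φ_c^∨)`: scalar multiplication by the
rational number `vol(K)` in the `ℚ`-algebra `M_μ`. [cite: Liu2021, §4.2 (4.3) (p. 56)] -/
def pairLevelVol (K : Subgroup D.G) (Dμ : D.Obj) (φ : D.HomK K Dμ) (φc : D.HomKc K Dμ) : fieldOfValues E D.μ :=
  (D.vol K : fieldOfValues E D.μ) * D.pairLevel K Dμ φ φc

/-- **[Liu2021, p. 56] independence of the level** (l. 2382), VERBATIM: «For sufficiently small `K` and `K' ⊆ K`, the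
degree of the transition morphism `u^{K'}_K` equals `vol(K) · vol(K')^{-1}` by Lemma 4.23 (2). Thus, by Lemma 4.23 (2)
and Proposition 2.7, we know that `(φ, φ_c)^K_μ` does not depend on the choice of `K`, which we define as `(φ, φ_c)_μ`.»
TYPED (the conclusion): for all sufficiently small open compact `K' ⊆ K`, every object `D_μ` and all `φ`, `φ_c` at level
`K`, the value at level `K'` of their images under the transition maps equals the value at level `K`.
[cite: Liu2021, §4.2 (4.3) (p. 56)] -/
def Liu2021_pairLevel_indepOfLevel : Prop :=
  ForAllSuffSmall D.toThm418Data fun K =>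
    ∀ (K' : Subgroup D.G) (hK' : K' ≤ K), IsOpenCompact K' →
      ∀ (Dμ : D.Obj) (φ : D.HomK K Dμ) (φc : D.HomKc K Dμ),
        D.pairLevelVol K' Dμ (D.transHom hK' Dμ φ) (D.transHomc hK' Dμ φc) = D.pairLevelVol K Dμ φ φc

/-- **[Liu2021, §4.2 display (4.3) and p. 56] the canonical pairing `( , )_μ`** (p. 55, l. 2326–2330, VERBATIM: «At the
end of this subsection, we will construct a canonical pairing `( , )_μ : Ω(μ) × Ω(μ^c) → M_μ` (4.3) that is
`M_μ`-bilinear, non-degenerate, and `𝔾(𝔸_F^∞)`-invariant.»; p. 56, l. 2382, VERBATIM: «It is clear from the construction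
that (4.3) is bilinear, independent of the choice of `D_μ`, non-degenerate since `θ_K` is a polarization for every `K`,
and `𝔾(𝔸_F^∞)`-invariant since `{D_K}_K` is functorial under Hecke translations.»).  TYPED: there is an `M_μ`-bilinear
map `P : Ω(μ) × Ω(μ^c) → M_μ` (Mathlib: `Ω(μ) →ₗ Ω(μ^c) →ₗ M_μ`) which (i) COMPUTES the construction — for EVERY object
`D_μ ∈ 𝒜(μ)` («independent of the choice of `D_μ`»), every sufficiently small open compact `K` and all `φ ∈ Hom_E(A_K,
A_μ)_ℚ`, `φ_c ∈ Hom_E(A_K, A_μ^∨)_ℚ`, `P(φ, φ_c) = (φ, φ_c)^K_μ = vol(K) · i_μ^{-1}(φ ∘ θ_K ∘ φ_c^∨)` on their images in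
`Ω(μ)`, `Ω(μ^c)` («It suffices to consider elements … we may choose some `K` such that both `φ` and `φ_c` factor through
`A_K`», p. 56) —, (ii) is non-degenerate (Mathlib `LinearMap.Nondegenerate`: left and right kernels trivial), and (iii)
is `𝔾(𝔸_F^∞)`-invariant: `P(g φ, g φ_c) = P(φ, φ_c)`. [cite: Liu2021, §4.2 (4.3) (p. 55–56)] -/
def Liu2021_Pairing43 : Prop :=
  ∃ P : D.Ω →ₗ[fieldOfValues E D.μ] D.Ωc →ₗ[fieldOfValues E D.μ] fieldOfValues E D.μ,
    (∀ Dμ : D.Obj, ForAllSuffSmall D.toThm418Data fun K =>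
        ∀ (φ : D.HomK K Dμ) (φc : D.HomKc K Dμ), P (D.res K Dμ φ) (D.resc K Dμ φc) = D.pairLevelVol K Dμ φ φc) ∧
    P.Nondegenerate ∧
    ∀ (g : D.G) (x : D.Ω) (y : D.Ωc), P (D.rhoΩ g x) (D.rhoΩc g y) = P x y

end Sec42IIData

end Literature.NumberTheory.Automorphic.Liu2021.Sec42AlbaneseUnitaryShimuraII

end
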